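import Summits.QuantumFields.YangMills.Theorems.BalabanUVNodesN11NoExpansionGeneralStepCoPHOldBranch
import Summits.QuantumFields.YangMills.Theorems.BalabanUVNodesN11RePinnedParamDefs
import Literature.MathematicalPhysics.QuantumFieldTheory.Balaban1983to89.Node00.Record13SepCoPRInhabitedOfSepCoP

/-!
# DAG node N11 — THE GENERAL-HISTORY NO-EXPANSION 𝐓-STEP AT THE RE-PINNED v1.7 PARAMETER `rePinH θ`: the residual-slot binders (P) `hpre`, (V) `hZ`, `hq`,
# `hqloc` of p544575 ∕ p547524 DISCHARGED AT EVERY NO-EXPANSION HISTORY (not only along the all-large-field diagonal) — what remains displayed is the clause at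
# `init s′` (`SLaw`), the old action's fluctuation-locality `hA` (or the witness's 𝐁-locality `hB`) and the measurability ∕ bound rows (`hm`∕`hC` or `hmB`∕`hCB`)

HEADER — WORK-UNIT METADATA.  Cell `pub-ymgap`, YM-PLAN Track A (HUMAN RULING D-0062), seat `pub-ymgap-dag-n11-d` (g9; R134 fan-out seat N11 [B14], strategy s2),
route `BalabanUVNodes` rev 25, item K1⁷ `StabilityBAtRecordR13SepCoPH` = stmt-QuantumFields-20542 (helper, `--kind proof --supports 20542 --as helper`, count-neutral).
[III] = [Balaban1988Convergent].  Over this seat's p544575 `…NoExpansionGeneralStepCoPH`, p547524 `…GeneralStepCoPHOldBranch`, p540862 `…NoExpansionDiagonalCoPH`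
(level one), the definition files `…N11HistoryPinnedResidualDefs` ∕ `…N11RePinnedParamDefs` (`ZhPinOfRecord₁₃`, `rePinH` and their faces), node00-def-K0a's FILE 18
(`Stage13RParams.ofCured`, `Provisos₁₃Core.ofCured`) and node00-def-T's door (`Stage13HParams.ofHistoryBlind`, `Provisos₁₃CoPR.ofHistoryBlind`).

WHY THIS FILE (director-ym №189 (3) STANDING A6 RULE; this seat's g8 ■ CLOSE «WHAT N11's 𝐓-LAW STILL NEEDS (a)»).  The general step p544575 holds for a GENERIC
`θ : Stage13HParams` under displayed binders; its A6 inhabitant p547792 reached the all-large DIAGONAL only, because the door witness is history-blind.  At the re-pinned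
parameter `rePinH θ` (ANY `θ`; in particular the re-pinned door of K0a's cured witness family) the four residual-slot binders are THEOREMS at EVERY no-expansion
history: (P) by level-freeness (`prefix_agree_rePinH`), (V) by `zhAt_rePinH_ζ0_univ_pairCfgAt`, `hq`∕`hqloc` by `quad ≡ 0`.  So Theorem 1's inductive 𝐓-step on EVERY
no-expansion branch after ANY history is, at `rePinH θ`, a consequence of `SLaw₁₃CoPH (rePinH θ) p k` and the three analytic rows ONLY (`hA`∕`hB`; `hm`∕`hC` or
`hmB`∕`hCB` — unchanged, g7∕g8's located dead ends: term values carry no global measurability law, the restricted-averaging kernel no bound).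

WHAT THIS FILE PROVES (0 `sorry`, 0 `def`, standard axioms; `N`-generic).  §1 `clause_one_rePinH_of_provisos` (level one: core provisos at `θ` + `0 < K`, `1 ≤ M`, NO pin
hypothesis) · §2 ★★ `clause_succ_rePinH_of_Omega_empty_of_provisos_of_clause` (clause-keyed general step at `rePinH θ`; displayed `hA`, `hid`, `hm`∕`hC` only) · ★★
`exists_clause_succ_rePinH_of_Omega_empty_of_sLaw₁₃CoPH` (keyed on `SLaw₁₃CoPH (rePinH θ) p k` itself; witness `t (init s′)`, `E_{k+1}(s′) := E_k(init s′)`) ·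
`clause_succ_rePinH_of_Omega_empty_of_BLocal_of_clause` (`hA` ⟸ `hB`) · §3 `clause_succ_rePinH_of_Omega_empty_of_oldBranch_of_clause`,
`exists_clause_succ_rePinH_of_Omega_empty_of_sLaw₁₃CoPH_of_oldBranch` (p547524's `hmB`∕`hCB` form) · §4 `provisos₁₃CoPH_rePinH_door_ofCured`, `zhAt_rePinH_door_seqAllLarge`
(on the diagonal the re-pinned door IS the door), ★★ `exists_clause_succ_rePinH_door_ofCured_of_Omega_empty` (at the RE-PINNED DOOR of K0a's cured witness family from
`θ₀.Provisos₁₃Core` + `SLaw` + `hA` + `hmB`∕`hCB` ONLY, at EVERY no-expansion history — the off-diagonal extension of p547792).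

HONEST FRAMING ∕ A6.  Count-neutral kernel bookkeeping; every theorem is an INSTANCE of p544575 ∕ p547524 ∕ p540862 at a NAMED tree term with the residual-slot binders
discharged by the definition files' faces; the displayed `hid`∕`hA`(`hB`)∕`hm`∕`hC`(`hmB`∕`hCB`) are exactly those of the accepted parents (inhabited: `hid` by the item's own
antecedent `SLaw₁₃CoPH … k`; `hA` along all-`Ω`-empty old terms, p547792 `hA_of_allLarge`; `hm`∕`hC` nowhere in the tree — located).  Nothing of Bałaban's asserted; the
certificate value is NOT H3's value of record; sequences with `Ω_{k+1} ≠ ∅` = [III] §3 ∕ Thm 2 proper, untouched; N11 NOT discharged; K1⁷ NOT closed; counts unmoved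
(typed 28∕28 · discharged 5∕28).  One finite four-torus programme at fixed `ε = L^{−K}` — NOT ℝ⁴, NOT OS, NOT a mass gap, NOT Clay.
Sources: [III] Theorem p.245, Thm 1 p.262, (1.11) p.248, (2.17)–(2.18) p.257, (2.20)–(2.25) pp.258–259, (2.40)–(2.41) p.261, (3.16) p.268, (3.24)–(3.25) p.270, p.267.
-/

noncomputable section

open MeasureTheory
open scoped BigOperators Matrix.Norms.L2Operator

namespace Summit.QuantumFields.YangMills.Theorems.BalabanUVNodesN11NoExpansionGeneralStepRePinned

open Literature.MathematicalPhysics.QuantumFieldTheory.Balaban1983to89 T4Continuum Node00 Node00.Tk DagBinding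
open B15DeterminingSets
open BalabanUVNodesN11HistoryPinnedResidualDefs BalabanUVNodesN11RePinnedParamDefs
open BalabanUVNodesN11NoExpansionDiagonalCoPH (hasSect2FormAtZS_clause_one_CoPH_of_provisos)
open BalabanUVNodesN11NoExpansionGeneralStepCoPH (clause_succ_CoPH_of_Omega_empty_of_pinChi_of_provisos_of_clause
  clause_succ_CoPH_of_Omega_empty_of_pinChi_of_BLocal_of_clause)
open BalabanUVNodesN11NoExpansionGeneralStepCoPHOldBranch (clause_succ_CoPH_of_Omega_empty_of_pinChi_of_oldBranch_of_clause)

variable {F : T4Family} {N : ℕ} [NeZero N]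

section RePinned

variable (θ : Stage13HParams F N) (p : B12.RunParams)

/-! ## §1  Level one at the re-pinned parameter: only `0 < K`, `1 ≤ M` and the core provisos remain -/

/-- **★ THE FIRST (S1ᵀ) CLAUSE AT THE RE-PINNED PARAMETER — NO PIN HYPOTHESIS.**  At `rePinH θ` and the all-large-field new sequence `s′` of length `1` (`Ω₁(s′) = ∅`), for
EVERY term-value witness `t`: the dichotomy clause of `TLaw₁₃CoPH (rePinH θ) p 0` at `s′`, identity branch, constant `E(p)` — from def-T's v1.7 core provisos AT `θ` (they
transfer, `provisos₁₃CoPH_rePinH`), `0 < K`, `1 ≤ M` ONLY (p540862's `hZ` by `zhAt_rePinH_ζ0_zero_univ_pairCfg`, `hq` by `rfl`).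
[cite: Balaban1988Convergent, Theorem p.245, (1.11) p.248, (2.17)–(2.18) p.257, (3.25) p.270, remark p.262] -/
theorem clause_one_rePinH_of_provisos (h : θ.Provisos₁₃CoPH F N) (hK : 0 < p.K) (hM : 1 ≤ θ.τ9.M)
    (s : SeqOfRecord F θ.ν θ.τ9.M (gOfRecord₁₃ F N θ.toStage13Params p) p.K 1) (hΩ : s.Ω 1 = ∅)
    (t : Sect2.TermValues (F.P p.K) (MatA N) (FluctV N) θ.τ9.M) :
    slotsTOfRecord F N θ.ν θ.τ9 (EOfRecord₁₃ F N θ.toStage13Params) (wOfRecord₉ F N θ.toStage9Params) θ.ppSel p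
        (gOfRecord₁₃ F N θ.toStage13Params p) 1 s = 0 ∨
      ∀ᵐ V1 ∂fieldMeasure (F.P p.K) 1 (SU N),
        chiSeqOfRecord F N θ.ν θ.τ9.M (gOfRecord₁₃ F N θ.toStage13Params p) p.K 1 s V1 ≠ 0 →
          slotsTOfRecord F N θ.ν θ.τ9 (EOfRecord₁₃ F N θ.toStage13Params) (wOfRecord₉ F N θ.toStage9Params) θ.ppSel p
              (gOfRecord₁₃ F N θ.toStage13Params p) 1 s V1 =
            sect2Slot F N (FluctV N) p.K (settingOfRecord₁₃ F N θ.toStage13Params p) (θ.rzAt p s) (WtOfRecord₁₃H F N (rePinH θ) p s) s t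
              (EOfRecord₁₃ F N θ.toStage13Params p) (UbgOfRecord₁₃CoP F N θ.toStage13Params p 1 s) V1 :=
  hasSect2FormAtZS_clause_one_CoPH_of_provisos (rePinH θ) p (provisos₁₃CoPH_rePinH h) hK hM s hΩ t
    (zhAt_rePinH_ζ0_zero_univ_pairCfg θ p hK s hΩ) (fun _ _ => rfl)

/-! ## §2  The no-expansion 𝐓-step after an ARBITRARY history at the re-pinned parameter -/

/-- **★★ THE GENERAL-HISTORY NO-EXPANSION 𝐓-STEP AT THE RE-PINNED PARAMETER, CLAUSE-KEYED** (p544575 `clause_succ_CoPH_of_Omega_empty_of_pinChi_of_provisos_of_clause` at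
`rePinH θ`): for EVERY history `s′` of length `k+1` with `Ω_{k+1}(s′) = ∅` (`k < K`, `1 ≤ M`, core provisos at `θ`), the clause of `SLaw` at `init s′` (residual and weights of
the re-pinned parameter) gives the 𝐓-image clause at `s′`, same `t`, same `E₀` — the binders (P) `hpre` (`prefix_agree_rePinH`), (V) `hZ` (`zhAt_rePinH_ζ0_univ_pairCfgAt`),
`hq`∕`hqloc` (`quad ≡ 0`) DISCHARGED; `hA` and `hm`∕`hC` displayed as in p544575. [cite: Balaban1988Convergent, Theorem p.245, (3.24)–(3.25) p.270, (2.18) p.257, (2.20)–(2.25) pp.258–259, (3.16) p.268] -/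
theorem clause_succ_rePinH_of_Omega_empty_of_provisos_of_clause (h : θ.Provisos₁₃CoPH F N) {k : ℕ} (hk : k < p.K) (hM : 1 ≤ θ.τ9.M)
    (s : SeqOfRecord F θ.ν θ.τ9.M (gOfRecord₁₃ F N θ.toStage13Params p) p.K (k + 1)) (hΩ : s.Ω (k + 1) = ∅)
    (t : Sect2.TermValues (F.P p.K) (MatA N) (FluctV N) θ.τ9.M) (E₀ : ℝ)
    (hA : ∀ (S : ℕ → Set (Site (F.P p.K) 0)) (a a' : Tk.MSFluct (F.P p.K) (FluctV N)) (Uf : GaugeField (F.P p.K) 0 (SU N)), (∀ i, i ≤ k → a i = a' i) →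
      (sect2ActionDataOfRecord F N (FluctV N) p.K (settingOfRecord₁₃ F N θ.toStage13Params p) (θ.rzAt p s.init) s.init t (S, a) E₀).action23 k Uf =
        (sect2ActionDataOfRecord F N (FluctV N) p.K (settingOfRecord₁₃ F N θ.toStage13Params p) (θ.rzAt p s.init) s.init t (S, a') E₀).action23 k Uf)
    (hid : slotsOfRecord F N θ.ν θ.τ9 (EOfRecord₁₃ F N θ.toStage13Params) (wOfRecord₉ F N θ.toStage9Params) θ.ppSel p
        (gOfRecord₁₃ F N θ.toStage13Params p) k s.init = 0 ∨
      ∀ᵐ U₀ ∂fieldMeasure (F.P p.K) k (SU N),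
        chiSeqOfRecord F N θ.ν θ.τ9.M (gOfRecord₁₃ F N θ.toStage13Params p) p.K k s.init U₀ ≠ 0 →
          slotsOfRecord F N θ.ν θ.τ9 (EOfRecord₁₃ F N θ.toStage13Params) (wOfRecord₉ F N θ.toStage9Params) θ.ppSel p
              (gOfRecord₁₃ F N θ.toStage13Params p) k s.init U₀ =
            sect2Slot F N (FluctV N) p.K (settingOfRecord₁₃ F N θ.toStage13Params p) (θ.rzAt p s.init) (WtOfRecord₁₃H F N (rePinH θ) p s.init) s.init t E₀
              (UbgOfRecord₁₃CoP F N θ.toStage13Params p k s.init) U₀)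
    {C : ℝ}
    (hm : ∀ S ∈ admSOfRecord F θ.ν θ.τ9.M (gOfRecord₁₃ F N θ.toStage13Params p) p.K k s.init,
      Measurable (Function.uncurry (noExpIntegrandAt F N (FluctV N) p.K k (WtOfRecord₁₃H F N (rePinH θ) p s)
        (tkBranchOfRecord F N (FluctV N) θ.ν θ.τ9.M _ p.K (WtOfRecord₁₃H F N (rePinH θ) p s) s.init S k
          (fun ω => sect2Operand F N (FluctV N) p.K (settingOfRecord₁₃ F N θ.toStage13Params p) (θ.rzAt p s) s t E₀
            (UbgOfRecord₁₃CoP F N θ.toStage13Params p (k + 1) s) (S, fun j => (ω j).2) (fun j => (ω j).1))))))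
    (hC : ∀ S ∈ admSOfRecord F θ.ν θ.τ9.M (gOfRecord₁₃ F N θ.toStage13Params p) p.K k s.init, ∀ V' U₀,
      |noExpIntegrandAt F N (FluctV N) p.K k (WtOfRecord₁₃H F N (rePinH θ) p s)
        (tkBranchOfRecord F N (FluctV N) θ.ν θ.τ9.M _ p.K (WtOfRecord₁₃H F N (rePinH θ) p s) s.init S k
          (fun ω => sect2Operand F N (FluctV N) p.K (settingOfRecord₁₃ F N θ.toStage13Params p) (θ.rzAt p s) s t E₀
            (UbgOfRecord₁₃CoP F N θ.toStage13Params p (k + 1) s) (S, fun j => (ω j).2) (fun j => (ω j).1)))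
        V' U₀| ≤ C) :
    slotsTOfRecord F N θ.ν θ.τ9 (EOfRecord₁₃ F N θ.toStage13Params) (wOfRecord₉ F N θ.toStage9Params) θ.ppSel p
        (gOfRecord₁₃ F N θ.toStage13Params p) (k + 1) s = 0 ∨
      ∀ᵐ V' ∂fieldMeasure (F.P p.K) (k + 1) (SU N),
        chiSeqOfRecord F N θ.ν θ.τ9.M (gOfRecord₁₃ F N θ.toStage13Params p) p.K (k + 1) s V' ≠ 0 →
          slotsTOfRecord F N θ.ν θ.τ9 (EOfRecord₁₃ F N θ.toStage13Params) (wOfRecord₉ F N θ.toStage9Params) θ.ppSel p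
              (gOfRecord₁₃ F N θ.toStage13Params p) (k + 1) s V' =
            sect2Slot F N (FluctV N) p.K (settingOfRecord₁₃ F N θ.toStage13Params p) (θ.rzAt p s) (WtOfRecord₁₃H F N (rePinH θ) p s) s t E₀
              (UbgOfRecord₁₃CoP F N θ.toStage13Params p (k + 1) s) V' :=
  clause_succ_CoPH_of_Omega_empty_of_pinChi_of_provisos_of_clause (rePinH θ) p (provisos₁₃CoPH_rePinH h) hk hM s hΩ
    (fun _ _ _ _ _ => rfl) (prefix_agree_rePinH θ p s hΩ) t E₀ hA hid (zhAt_rePinH_ζ0_univ_pairCfgAt θ p hk s hΩ) (fun _ _ => rfl) hm hC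

/-- **… keyed on `SLaw₁₃CoPH (rePinH θ) p k` ITSELF**: its witness `(t, E_k)` supplies the clause at `init s′`; the 𝐓-image clause at `s′` holds for `t (init s′)` with
`E_{k+1}(s′) := E_k(init s′)` — Theorem 1's inductive 𝐓-step on EVERY no-expansion branch after ANY history, at the re-pinned parameter, with ONLY `hA` and `hm`∕`hC`
displayed (for every `(t₀, E₀)`). [cite: Balaban1988Convergent, Theorem p.245, Thm 1 p.262, (3.24)–(3.25) p.270] -/
theorem exists_clause_succ_rePinH_of_Omega_empty_of_sLaw₁₃CoPH (h : θ.Provisos₁₃CoPH F N) {k : ℕ} (hk : k < p.K) (hM : 1 ≤ θ.τ9.M)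
    (hS : SLaw₁₃CoPH F N (rePinH θ) p k)
    (s : SeqOfRecord F θ.ν θ.τ9.M (gOfRecord₁₃ F N θ.toStage13Params p) p.K (k + 1)) (hΩ : s.Ω (k + 1) = ∅)
    (hA : ∀ (t₀ : Sect2.TermValues (F.P p.K) (MatA N) (FluctV N) θ.τ9.M) (E₀ : ℝ) (S : ℕ → Set (Site (F.P p.K) 0))
      (a a' : Tk.MSFluct (F.P p.K) (FluctV N)) (Uf : GaugeField (F.P p.K) 0 (SU N)), (∀ i, i ≤ k → a i = a' i) →
      (sect2ActionDataOfRecord F N (FluctV N) p.K (settingOfRecord₁₃ F N θ.toStage13Params p) (θ.rzAt p s.init) s.init t₀ (S, a) E₀).action23 k Uf =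
        (sect2ActionDataOfRecord F N (FluctV N) p.K (settingOfRecord₁₃ F N θ.toStage13Params p) (θ.rzAt p s.init) s.init t₀ (S, a') E₀).action23 k Uf)
    {C : ℝ}
    (hm : ∀ (t₀ : Sect2.TermValues (F.P p.K) (MatA N) (FluctV N) θ.τ9.M) (E₀ : ℝ),
      ∀ S ∈ admSOfRecord F θ.ν θ.τ9.M (gOfRecord₁₃ F N θ.toStage13Params p) p.K k s.init,
      Measurable (Function.uncurry (noExpIntegrandAt F N (FluctV N) p.K k (WtOfRecord₁₃H F N (rePinH θ) p s)
        (tkBranchOfRecord F N (FluctV N) θ.ν θ.τ9.M _ p.K (WtOfRecord₁₃H F N (rePinH θ) p s) s.init S k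
          (fun ω => sect2Operand F N (FluctV N) p.K (settingOfRecord₁₃ F N θ.toStage13Params p) (θ.rzAt p s) s t₀ E₀
            (UbgOfRecord₁₃CoP F N θ.toStage13Params p (k + 1) s) (S, fun j => (ω j).2) (fun j => (ω j).1))))))
    (hC : ∀ (t₀ : Sect2.TermValues (F.P p.K) (MatA N) (FluctV N) θ.τ9.M) (E₀ : ℝ),
      ∀ S ∈ admSOfRecord F θ.ν θ.τ9.M (gOfRecord₁₃ F N θ.toStage13Params p) p.K k s.init, ∀ V' U₀,
      |noExpIntegrandAt F N (FluctV N) p.K k (WtOfRecord₁₃H F N (rePinH θ) p s)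
        (tkBranchOfRecord F N (FluctV N) θ.ν θ.τ9.M _ p.K (WtOfRecord₁₃H F N (rePinH θ) p s) s.init S k
          (fun ω => sect2Operand F N (FluctV N) p.K (settingOfRecord₁₃ F N θ.toStage13Params p) (θ.rzAt p s) s t₀ E₀
            (UbgOfRecord₁₃CoP F N θ.toStage13Params p (k + 1) s) (S, fun j => (ω j).2) (fun j => (ω j).1)))
        V' U₀| ≤ C) :
    ∃ (t₀ : Sect2.TermValues (F.P p.K) (MatA N) (FluctV N) θ.τ9.M) (E' : ℝ),
      slotsTOfRecord F N θ.ν θ.τ9 (EOfRecord₁₃ F N θ.toStage13Params) (wOfRecord₉ F N θ.toStage9Params) θ.ppSel p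
          (gOfRecord₁₃ F N θ.toStage13Params p) (k + 1) s = 0 ∨
        ∀ᵐ V' ∂fieldMeasure (F.P p.K) (k + 1) (SU N),
          chiSeqOfRecord F N θ.ν θ.τ9.M (gOfRecord₁₃ F N θ.toStage13Params p) p.K (k + 1) s V' ≠ 0 →
            slotsTOfRecord F N θ.ν θ.τ9 (EOfRecord₁₃ F N θ.toStage13Params) (wOfRecord₉ F N θ.toStage9Params) θ.ppSel p
                (gOfRecord₁₃ F N θ.toStage13Params p) (k + 1) s V' =
              sect2Slot F N (FluctV N) p.K (settingOfRecord₁₃ F N θ.toStage13Params p) (θ.rzAt p s) (WtOfRecord₁₃H F N (rePinH θ) p s) s t₀ E'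
                (UbgOfRecord₁₃CoP F N θ.toStage13Params p (k + 1) s) V' := by
  obtain ⟨t, Ek, -, hs⟩ := (sLaw₁₃CoPH_iff F N (rePinH θ) p k).1 hS
  exact ⟨t s.init, Ek s.init, clause_succ_rePinH_of_Omega_empty_of_provisos_of_clause θ p h hk hM s hΩ (t s.init) (Ek s.init)
    (hA _ _) (hs s.init).2 (hm _ _) (hC _ _)⟩

/-- **… with `hA` DISCHARGED FROM THE SCALE-LOCALITY OF THE WITNESS's 𝐁-TERMS** (`hB`, as p544575 `…_of_BLocal_of_clause`). [cite: Balaban1988Convergent, (2.40)–(2.41) p.261, (3.24)–(3.25) p.270] -/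
theorem clause_succ_rePinH_of_Omega_empty_of_BLocal_of_clause (h : θ.Provisos₁₃CoPH F N) {k : ℕ} (hk : k < p.K) (hM : 1 ≤ θ.τ9.M)
    (s : SeqOfRecord F θ.ν θ.τ9.M (gOfRecord₁₃ F N θ.toStage13Params p) p.K (k + 1)) (hΩ : s.Ω (k + 1) = ∅)
    (t : Sect2.TermValues (F.P p.K) (MatA N) (FluctV N) θ.τ9.M) (E₀ : ℝ)
    (hB : ∀ (S : ℕ → Set (Site (F.P p.K) 0)) (j : ℕ), 1 ≤ j → j ≤ k → ∀ (X : (Sect2.domSys (F.P p.K) θ.τ9.M j).Dom) (u : Sect2.CPair (F.P p.K) (MatA N))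
      (a a' : Tk.MSFluct (F.P p.K) (FluctV N)), (∀ i, i ≤ k → a i = a' i) → t.B j X u (S, a) = t.B j X u (S, a'))
    (hid : slotsOfRecord F N θ.ν θ.τ9 (EOfRecord₁₃ F N θ.toStage13Params) (wOfRecord₉ F N θ.toStage9Params) θ.ppSel p
        (gOfRecord₁₃ F N θ.toStage13Params p) k s.init = 0 ∨
      ∀ᵐ U₀ ∂fieldMeasure (F.P p.K) k (SU N),
        chiSeqOfRecord F N θ.ν θ.τ9.M (gOfRecord₁₃ F N θ.toStage13Params p) p.K k s.init U₀ ≠ 0 →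
          slotsOfRecord F N θ.ν θ.τ9 (EOfRecord₁₃ F N θ.toStage13Params) (wOfRecord₉ F N θ.toStage9Params) θ.ppSel p
              (gOfRecord₁₃ F N θ.toStage13Params p) k s.init U₀ =
            sect2Slot F N (FluctV N) p.K (settingOfRecord₁₃ F N θ.toStage13Params p) (θ.rzAt p s.init) (WtOfRecord₁₃H F N (rePinH θ) p s.init) s.init t E₀
              (UbgOfRecord₁₃CoP F N θ.toStage13Params p k s.init) U₀)
    {C : ℝ}
    (hm : ∀ S ∈ admSOfRecord F θ.ν θ.τ9.M (gOfRecord₁₃ F N θ.toStage13Params p) p.K k s.init,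
      Measurable (Function.uncurry (noExpIntegrandAt F N (FluctV N) p.K k (WtOfRecord₁₃H F N (rePinH θ) p s)
        (tkBranchOfRecord F N (FluctV N) θ.ν θ.τ9.M _ p.K (WtOfRecord₁₃H F N (rePinH θ) p s) s.init S k
          (fun ω => sect2Operand F N (FluctV N) p.K (settingOfRecord₁₃ F N θ.toStage13Params p) (θ.rzAt p s) s t E₀
            (UbgOfRecord₁₃CoP F N θ.toStage13Params p (k + 1) s) (S, fun j => (ω j).2) (fun j => (ω j).1))))))
    (hC : ∀ S ∈ admSOfRecord F θ.ν θ.τ9.M (gOfRecord₁₃ F N θ.toStage13Params p) p.K k s.init, ∀ V' U₀,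
      |noExpIntegrandAt F N (FluctV N) p.K k (WtOfRecord₁₃H F N (rePinH θ) p s)
        (tkBranchOfRecord F N (FluctV N) θ.ν θ.τ9.M _ p.K (WtOfRecord₁₃H F N (rePinH θ) p s) s.init S k
          (fun ω => sect2Operand F N (FluctV N) p.K (settingOfRecord₁₃ F N θ.toStage13Params p) (θ.rzAt p s) s t E₀
            (UbgOfRecord₁₃CoP F N θ.toStage13Params p (k + 1) s) (S, fun j => (ω j).2) (fun j => (ω j).1)))
        V' U₀| ≤ C) :
    slotsTOfRecord F N θ.ν θ.τ9 (EOfRecord₁₃ F N θ.toStage13Params) (wOfRecord₉ F N θ.toStage9Params) θ.ppSel p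
        (gOfRecord₁₃ F N θ.toStage13Params p) (k + 1) s = 0 ∨
      ∀ᵐ V' ∂fieldMeasure (F.P p.K) (k + 1) (SU N),
        chiSeqOfRecord F N θ.ν θ.τ9.M (gOfRecord₁₃ F N θ.toStage13Params p) p.K (k + 1) s V' ≠ 0 →
          slotsTOfRecord F N θ.ν θ.τ9 (EOfRecord₁₃ F N θ.toStage13Params) (wOfRecord₉ F N θ.toStage9Params) θ.ppSel p
              (gOfRecord₁₃ F N θ.toStage13Params p) (k + 1) s V' =
            sect2Slot F N (FluctV N) p.K (settingOfRecord₁₃ F N θ.toStage13Params p) (θ.rzAt p s) (WtOfRecord₁₃H F N (rePinH θ) p s) s t E₀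
              (UbgOfRecord₁₃CoP F N θ.toStage13Params p (k + 1) s) V' :=
  clause_succ_CoPH_of_Omega_empty_of_pinChi_of_BLocal_of_clause (rePinH θ) p (provisos₁₃CoPH_rePinH h) hk hM s hΩ
    (fun _ _ _ _ _ => rfl) (prefix_agree_rePinH θ p s hΩ) t E₀ hB hid (zhAt_rePinH_ζ0_univ_pairCfgAt θ p hk s hΩ) (fun _ _ => rfl) hm hC

/-! ## §3  The same with the measurability ∕ bound asked of the OLD branch only (p547524's form) -/

/-- **★★ THE GENERAL-HISTORY NO-EXPANSION 𝐓-STEP AT THE RE-PINNED PARAMETER, OLD-BRANCH FORM** (p547524 `clause_succ_CoPH_of_Omega_empty_of_pinChi_of_oldBranch_of_clause`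
at `rePinH θ`): as §2 with `hm`∕`hC` replaced by measurability ∕ bound of the OLD branch `U ↦ 𝐓_k(init s′, S)[e^{A_k(init s′)}](U)` (`hmB`∕`hCB`); (P), (V), `hq`, `hqloc`
DISCHARGED. [cite: Balaban1988Convergent, Theorem p.245, (3.24)–(3.25) p.270, (2.18) p.257, (2.20)–(2.25) pp.258–259, (3.16) p.268] -/
theorem clause_succ_rePinH_of_Omega_empty_of_oldBranch_of_clause (h : θ.Provisos₁₃CoPH F N) {k : ℕ} (hk : k < p.K) (hM : 1 ≤ θ.τ9.M)
    (s : SeqOfRecord F θ.ν θ.τ9.M (gOfRecord₁₃ F N θ.toStage13Params p) p.K (k + 1)) (hΩ : s.Ω (k + 1) = ∅)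
    (t : Sect2.TermValues (F.P p.K) (MatA N) (FluctV N) θ.τ9.M) (E₀ : ℝ)
    (hA : ∀ (S : ℕ → Set (Site (F.P p.K) 0)) (a a' : Tk.MSFluct (F.P p.K) (FluctV N)) (Uf : GaugeField (F.P p.K) 0 (SU N)), (∀ i, i ≤ k → a i = a' i) →
      (sect2ActionDataOfRecord F N (FluctV N) p.K (settingOfRecord₁₃ F N θ.toStage13Params p) (θ.rzAt p s.init) s.init t (S, a) E₀).action23 k Uf =
        (sect2ActionDataOfRecord F N (FluctV N) p.K (settingOfRecord₁₃ F N θ.toStage13Params p) (θ.rzAt p s.init) s.init t (S, a') E₀).action23 k Uf)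
    (hid : slotsOfRecord F N θ.ν θ.τ9 (EOfRecord₁₃ F N θ.toStage13Params) (wOfRecord₉ F N θ.toStage9Params) θ.ppSel p
        (gOfRecord₁₃ F N θ.toStage13Params p) k s.init = 0 ∨
      ∀ᵐ U₀ ∂fieldMeasure (F.P p.K) k (SU N),
        chiSeqOfRecord F N θ.ν θ.τ9.M (gOfRecord₁₃ F N θ.toStage13Params p) p.K k s.init U₀ ≠ 0 →
          slotsOfRecord F N θ.ν θ.τ9 (EOfRecord₁₃ F N θ.toStage13Params) (wOfRecord₉ F N θ.toStage9Params) θ.ppSel p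
              (gOfRecord₁₃ F N θ.toStage13Params p) k s.init U₀ =
            sect2Slot F N (FluctV N) p.K (settingOfRecord₁₃ F N θ.toStage13Params p) (θ.rzAt p s.init) (WtOfRecord₁₃H F N (rePinH θ) p s.init) s.init t E₀
              (UbgOfRecord₁₃CoP F N θ.toStage13Params p k s.init) U₀)
    {C : ℝ}
    (hmB : ∀ S ∈ admSOfRecord F θ.ν θ.τ9.M (gOfRecord₁₃ F N θ.toStage13Params p) p.K k s.init,
      Measurable fun U₀ : GaugeField (F.P p.K) k (SU N) =>
        tkBranchOfRecord F N (FluctV N) θ.ν θ.τ9.M _ p.K (WtOfRecord₁₃H F N (rePinH θ) p s) s.init S k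
          (fun ω => sect2Operand F N (FluctV N) p.K (settingOfRecord₁₃ F N θ.toStage13Params p) (θ.rzAt p s.init) s.init t E₀
            (UbgOfRecord₁₃CoP F N θ.toStage13Params p k s.init) (S, fun j => (ω j).2) (fun j => (ω j).1))
          (baseCfg (V := FluctV N) k U₀))
    (hCB : ∀ S ∈ admSOfRecord F θ.ν θ.τ9.M (gOfRecord₁₃ F N θ.toStage13Params p) p.K k s.init, ∀ U₀ : GaugeField (F.P p.K) k (SU N),
      |tkBranchOfRecord F N (FluctV N) θ.ν θ.τ9.M _ p.K (WtOfRecord₁₃H F N (rePinH θ) p s) s.init S k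
          (fun ω => sect2Operand F N (FluctV N) p.K (settingOfRecord₁₃ F N θ.toStage13Params p) (θ.rzAt p s.init) s.init t E₀
            (UbgOfRecord₁₃CoP F N θ.toStage13Params p k s.init) (S, fun j => (ω j).2) (fun j => (ω j).1))
          (baseCfg (V := FluctV N) k U₀)| ≤ C) :
    slotsTOfRecord F N θ.ν θ.τ9 (EOfRecord₁₃ F N θ.toStage13Params) (wOfRecord₉ F N θ.toStage9Params) θ.ppSel p
        (gOfRecord₁₃ F N θ.toStage13Params p) (k + 1) s = 0 ∨
      ∀ᵐ V' ∂fieldMeasure (F.P p.K) (k + 1) (SU N),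
        chiSeqOfRecord F N θ.ν θ.τ9.M (gOfRecord₁₃ F N θ.toStage13Params p) p.K (k + 1) s V' ≠ 0 →
          slotsTOfRecord F N θ.ν θ.τ9 (EOfRecord₁₃ F N θ.toStage13Params) (wOfRecord₉ F N θ.toStage9Params) θ.ppSel p
              (gOfRecord₁₃ F N θ.toStage13Params p) (k + 1) s V' =
            sect2Slot F N (FluctV N) p.K (settingOfRecord₁₃ F N θ.toStage13Params p) (θ.rzAt p s) (WtOfRecord₁₃H F N (rePinH θ) p s) s t E₀
              (UbgOfRecord₁₃CoP F N θ.toStage13Params p (k + 1) s) V' :=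
  clause_succ_CoPH_of_Omega_empty_of_pinChi_of_oldBranch_of_clause (rePinH θ) p (provisos₁₃CoPH_rePinH h) hk hM s hΩ
    (fun _ _ _ _ _ => rfl) (prefix_agree_rePinH θ p s hΩ) t E₀ hA hid (zhAt_rePinH_ζ0_univ_pairCfgAt θ p hk s hΩ) (fun _ _ => rfl) hmB hCB

/-- **… keyed on `SLaw₁₃CoPH (rePinH θ) p k` ITSELF, old-branch form.** [cite: Balaban1988Convergent, Theorem p.245, Thm 1 p.262, (3.24)–(3.25) p.270] -/
theorem exists_clause_succ_rePinH_of_Omega_empty_of_sLaw₁₃CoPH_of_oldBranch (h : θ.Provisos₁₃CoPH F N) {k : ℕ} (hk : k < p.K) (hM : 1 ≤ θ.τ9.M)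
    (hS : SLaw₁₃CoPH F N (rePinH θ) p k)
    (s : SeqOfRecord F θ.ν θ.τ9.M (gOfRecord₁₃ F N θ.toStage13Params p) p.K (k + 1)) (hΩ : s.Ω (k + 1) = ∅)
    (hA : ∀ (t₀ : Sect2.TermValues (F.P p.K) (MatA N) (FluctV N) θ.τ9.M) (E₀ : ℝ) (S : ℕ → Set (Site (F.P p.K) 0))
      (a a' : Tk.MSFluct (F.P p.K) (FluctV N)) (Uf : GaugeField (F.P p.K) 0 (SU N)), (∀ i, i ≤ k → a i = a' i) →
      (sect2ActionDataOfRecord F N (FluctV N) p.K (settingOfRecord₁₃ F N θ.toStage13Params p) (θ.rzAt p s.init) s.init t₀ (S, a) E₀).action23 k Uf =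
        (sect2ActionDataOfRecord F N (FluctV N) p.K (settingOfRecord₁₃ F N θ.toStage13Params p) (θ.rzAt p s.init) s.init t₀ (S, a') E₀).action23 k Uf)
    {C : ℝ}
    (hmB : ∀ (t₀ : Sect2.TermValues (F.P p.K) (MatA N) (FluctV N) θ.τ9.M) (E₀ : ℝ),
      ∀ S ∈ admSOfRecord F θ.ν θ.τ9.M (gOfRecord₁₃ F N θ.toStage13Params p) p.K k s.init,
      Measurable fun U₀ : GaugeField (F.P p.K) k (SU N) =>
        tkBranchOfRecord F N (FluctV N) θ.ν θ.τ9.M _ p.K (WtOfRecord₁₃H F N (rePinH θ) p s) s.init S k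
          (fun ω => sect2Operand F N (FluctV N) p.K (settingOfRecord₁₃ F N θ.toStage13Params p) (θ.rzAt p s.init) s.init t₀ E₀
            (UbgOfRecord₁₃CoP F N θ.toStage13Params p k s.init) (S, fun j => (ω j).2) (fun j => (ω j).1))
          (baseCfg (V := FluctV N) k U₀))
    (hCB : ∀ (t₀ : Sect2.TermValues (F.P p.K) (MatA N) (FluctV N) θ.τ9.M) (E₀ : ℝ),
      ∀ S ∈ admSOfRecord F θ.ν θ.τ9.M (gOfRecord₁₃ F N θ.toStage13Params p) p.K k s.init, ∀ U₀ : GaugeField (F.P p.K) k (SU N),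
      |tkBranchOfRecord F N (FluctV N) θ.ν θ.τ9.M _ p.K (WtOfRecord₁₃H F N (rePinH θ) p s) s.init S k
          (fun ω => sect2Operand F N (FluctV N) p.K (settingOfRecord₁₃ F N θ.toStage13Params p) (θ.rzAt p s.init) s.init t₀ E₀
            (UbgOfRecord₁₃CoP F N θ.toStage13Params p k s.init) (S, fun j => (ω j).2) (fun j => (ω j).1))
          (baseCfg (V := FluctV N) k U₀)| ≤ C) :
    ∃ (t₀ : Sect2.TermValues (F.P p.K) (MatA N) (FluctV N) θ.τ9.M) (E' : ℝ),
      slotsTOfRecord F N θ.ν θ.τ9 (EOfRecord₁₃ F N θ.toStage13Params) (wOfRecord₉ F N θ.toStage9Params) θ.ppSel p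
          (gOfRecord₁₃ F N θ.toStage13Params p) (k + 1) s = 0 ∨
        ∀ᵐ V' ∂fieldMeasure (F.P p.K) (k + 1) (SU N),
          chiSeqOfRecord F N θ.ν θ.τ9.M (gOfRecord₁₃ F N θ.toStage13Params p) p.K (k + 1) s V' ≠ 0 →
            slotsTOfRecord F N θ.ν θ.τ9 (EOfRecord₁₃ F N θ.toStage13Params) (wOfRecord₉ F N θ.toStage9Params) θ.ppSel p
                (gOfRecord₁₃ F N θ.toStage13Params p) (k + 1) s V' =
              sect2Slot F N (FluctV N) p.K (settingOfRecord₁₃ F N θ.toStage13Params p) (θ.rzAt p s) (WtOfRecord₁₃H F N (rePinH θ) p s) s t₀ E'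
                (UbgOfRecord₁₃CoP F N θ.toStage13Params p (k + 1) s) V' := by
  obtain ⟨t, Ek, -, hs⟩ := (sLaw₁₃CoPH_iff F N (rePinH θ) p k).1 hS
  exact ⟨t s.init, Ek s.init, clause_succ_rePinH_of_Omega_empty_of_oldBranch_of_clause θ p h hk hM s hΩ (t s.init) (Ek s.init)
    (hA _ _) (hs s.init).2 (hmB _ _) (hCB _ _)⟩

end RePinned

/-! ## §4  At the re-pinned door of node00-def-K0a's cured witness family: from `θ₀.Provisos₁₃Core` alone (off the diagonal too) -/

section Door

variable (θ₀ : Stage13Params F N) (p : B12.RunParams)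

/-- **def-T's v1.7 core provisos AT THE RE-PINNED DOOR OF K0a's CURED WITNESS** from `θ₀.Provisos₁₃Core` (K0a `Provisos₁₃Core.ofCured`, def-T `Provisos₁₃CoPR.ofHistoryBlind`,
this seat `provisos₁₃CoPH_rePinH`). [cite: Balaban1988Convergent, (2.18) p.257, (3.16) p.268, p.267 (bookkeeping)] -/
theorem provisos₁₃CoPH_rePinH_door_ofCured (h : θ₀.Provisos₁₃Core F N) :
    (rePinH (Stage13HParams.ofHistoryBlind F N (Stage13RParams.ofCured F N θ₀))).Provisos₁₃CoPH F N :=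
  provisos₁₃CoPH_rePinH h.ofCured.ofHistoryBlind

/-- **ON THE DIAGONAL THE RE-PINNED DOOR IS THE DOOR** (the residual serving the all-large index of any length is K0a's cured residual, which IS the door's):
`(rePinH door).zhAt p s′_n = door.zhAt p s′_n`. [cite: Balaban1988Convergent, (1.11) p.248, p.267, (3.16)–(3.20) pp.268–269 (bookkeeping)] -/
theorem zhAt_rePinH_door_seqAllLarge (θr : Stage13RParams F N) (hZr : θr.Zr p = ZrOfRecord₁₃ F N θr.toStage13Params p) (n : ℕ) :
    (rePinH (Stage13HParams.ofHistoryBlind F N θr)).zhAt p (seqAllLargeOfRecord F θr.ν θr.τ9.M (gOfRecord₁₃ F N θr.toStage13Params p) p.K n) =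
      (Stage13HParams.ofHistoryBlind F N θr).zhAt p (seqAllLargeOfRecord F θr.ν θr.τ9.M (gOfRecord₁₃ F N θr.toStage13Params p) p.K n) := by
  rw [Stage13HParams.zhAt_ofHistoryBlind, hZr]
  exact zhAt_rePinH_seqAllLarge (Stage13HParams.ofHistoryBlind F N θr) p n

/-- **… hence the 𝐓-WEIGHTS serving the all-large index agree at the re-pinned door and at the door** (12a″'s `tkWeightsOfRecordP` over the same residual): every
clause-level statement of this seat's ∕ dag-n11-e's DIAGONAL files at the door (weights `WtOfRecord₁₃H door p s′_n`) holds VERBATIM at the re-pinned door.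
[cite: Balaban1988Convergent, (2.21) p.258, (3.16) p.268 (bookkeeping)] -/
theorem WtOfRecord₁₃H_rePinH_door_seqAllLarge (θr : Stage13RParams F N) (hZr : θr.Zr p = ZrOfRecord₁₃ F N θr.toStage13Params p) (n : ℕ) :
    WtOfRecord₁₃H F N (rePinH (Stage13HParams.ofHistoryBlind F N θr)) p
        (seqAllLargeOfRecord F θr.ν θr.τ9.M (gOfRecord₁₃ F N θr.toStage13Params p) p.K n) =
      WtOfRecord₁₃H F N (Stage13HParams.ofHistoryBlind F N θr) p (seqAllLargeOfRecord F θr.ν θr.τ9.M (gOfRecord₁₃ F N θr.toStage13Params p) p.K n) := by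
  unfold WtOfRecord₁₃H
  exact congrArg _ (zhAt_rePinH_door_seqAllLarge p θr hZr n)

/-- **★★ THE GENERAL-HISTORY NO-EXPANSION 𝐓-STEP AT THE RE-PINNED DOOR OF K0a's CURED WITNESS, AT EVERY NO-EXPANSION HISTORY** (this seat's door file p547792 reached
the DIAGONAL only): from `θ₀.Provisos₁₃Core`, `SLaw₁₃CoPH` there at level `k`, `k < K`, `1 ≤ M`, the old action's fluctuation-locality `hA` and the old-branch `hmB`∕`hCB`
ONLY — for EVERY `s′` of length `k+1` with `Ω_{k+1}(s′) = ∅`, whatever `Ω_1(s′), …, Ω_k(s′)`. [cite: Balaban1988Convergent, Theorem p.245, Thm 1 p.262, (3.24)–(3.25) p.270, (2.18) p.257, (2.20)–(2.25) pp.258–259] -/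
theorem exists_clause_succ_rePinH_door_ofCured_of_Omega_empty (h : θ₀.Provisos₁₃Core F N) {k : ℕ} (hk : k < p.K) (hM : 1 ≤ θ₀.τ9.M)
    (hS : SLaw₁₃CoPH F N (rePinH (Stage13HParams.ofHistoryBlind F N (Stage13RParams.ofCured F N θ₀))) p k)
    (s : SeqOfRecord F θ₀.ν θ₀.τ9.M (gOfRecord₁₃ F N θ₀ p) p.K (k + 1)) (hΩ : s.Ω (k + 1) = ∅)
    (hA : ∀ (t₀ : Sect2.TermValues (F.P p.K) (MatA N) (FluctV N) θ₀.τ9.M) (E₀ : ℝ) (S : ℕ → Set (Site (F.P p.K) 0))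
      (a a' : Tk.MSFluct (F.P p.K) (FluctV N)) (Uf : GaugeField (F.P p.K) 0 (SU N)), (∀ i, i ≤ k → a i = a' i) →
      (sect2ActionDataOfRecord F N (FluctV N) p.K (settingOfRecord₁₃ F N θ₀ p) (θ₀.Rz p.K) s.init t₀ (S, a) E₀).action23 k Uf =
        (sect2ActionDataOfRecord F N (FluctV N) p.K (settingOfRecord₁₃ F N θ₀ p) (θ₀.Rz p.K) s.init t₀ (S, a') E₀).action23 k Uf)
    {C : ℝ}
    (hmB : ∀ (t₀ : Sect2.TermValues (F.P p.K) (MatA N) (FluctV N) θ₀.τ9.M) (E₀ : ℝ),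
      ∀ S ∈ admSOfRecord F θ₀.ν θ₀.τ9.M (gOfRecord₁₃ F N θ₀ p) p.K k s.init,
      Measurable fun U₀ : GaugeField (F.P p.K) k (SU N) =>
        tkBranchOfRecord F N (FluctV N) θ₀.ν θ₀.τ9.M _ p.K
          (WtOfRecord₁₃H F N (rePinH (Stage13HParams.ofHistoryBlind F N (Stage13RParams.ofCured F N θ₀))) p s) s.init S k
          (fun ω => sect2Operand F N (FluctV N) p.K (settingOfRecord₁₃ F N θ₀ p) (θ₀.Rz p.K) s.init t₀ E₀
            (UbgOfRecord₁₃CoP F N θ₀ p k s.init) (S, fun j => (ω j).2) (fun j => (ω j).1))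
          (baseCfg (V := FluctV N) k U₀))
    (hCB : ∀ (t₀ : Sect2.TermValues (F.P p.K) (MatA N) (FluctV N) θ₀.τ9.M) (E₀ : ℝ),
      ∀ S ∈ admSOfRecord F θ₀.ν θ₀.τ9.M (gOfRecord₁₃ F N θ₀ p) p.K k s.init, ∀ U₀ : GaugeField (F.P p.K) k (SU N),
      |tkBranchOfRecord F N (FluctV N) θ₀.ν θ₀.τ9.M _ p.K
          (WtOfRecord₁₃H F N (rePinH (Stage13HParams.ofHistoryBlind F N (Stage13RParams.ofCured F N θ₀))) p s) s.init S k
          (fun ω => sect2Operand F N (FluctV N) p.K (settingOfRecord₁₃ F N θ₀ p) (θ₀.Rz p.K) s.init t₀ E₀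
            (UbgOfRecord₁₃CoP F N θ₀ p k s.init) (S, fun j => (ω j).2) (fun j => (ω j).1))
          (baseCfg (V := FluctV N) k U₀)| ≤ C) :
    ∃ (t₀ : Sect2.TermValues (F.P p.K) (MatA N) (FluctV N) θ₀.τ9.M) (E' : ℝ),
      slotsTOfRecord F N θ₀.ν θ₀.τ9 (EOfRecord₁₃ F N θ₀) (wOfRecord₉ F N θ₀.toStage9Params) θ₀.ppSel p (gOfRecord₁₃ F N θ₀ p) (k + 1) s = 0 ∨
        ∀ᵐ V' ∂fieldMeasure (F.P p.K) (k + 1) (SU N),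
          chiSeqOfRecord F N θ₀.ν θ₀.τ9.M (gOfRecord₁₃ F N θ₀ p) p.K (k + 1) s V' ≠ 0 →
            slotsTOfRecord F N θ₀.ν θ₀.τ9 (EOfRecord₁₃ F N θ₀) (wOfRecord₉ F N θ₀.toStage9Params) θ₀.ppSel p (gOfRecord₁₃ F N θ₀ p) (k + 1) s V' =
              sect2Slot F N (FluctV N) p.K (settingOfRecord₁₃ F N θ₀ p) (θ₀.Rz p.K)
                (WtOfRecord₁₃H F N (rePinH (Stage13HParams.ofHistoryBlind F N (Stage13RParams.ofCured F N θ₀))) p s) s t₀ E'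
                (UbgOfRecord₁₃CoP F N θ₀ p (k + 1) s) V' :=
  exists_clause_succ_rePinH_of_Omega_empty_of_sLaw₁₃CoPH_of_oldBranch (Stage13HParams.ofHistoryBlind F N (Stage13RParams.ofCured F N θ₀)) p
    h.ofCured.ofHistoryBlind hk hM hS s hΩ hA hmB hCB

end Door

end Summit.QuantumFields.YangMills.Theorems.BalabanUVNodesN11NoExpansionGeneralStepRePinned

end
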